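import Summits.ResolutionOfSingularities.ResolutionOfSingularities.Theorems.FrobeniusClosingSteerNotCoarseningArchSeq
import Mathlib.Algebra.Order.GroupWithZero.Basic
import Mathlib.Algebra.BigOperators.Group.Finset.Basic
import HarnessLib

/-!
# Crux `Steer` (stmt-ResolutionOfSingularities-16345), line `switching_dichotomy` r24: the (α) heart S3ᴹ, res-L0-w41-strat-1's
# distance dichotomy D1♯ — CYCLE RADII: bounded monomialization delays force divergent radii (a), and divergent radii make
# `t` a limit of `Frac A₀` (b)

OURS (campaign `res-hironaka`, rung L ★L-G4, slot W4.1, chain W4.1; seat `res-L0-w41-stub-4` g3, named «natural owner» by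
res-L0-w41-strat-1 CENSUS rev 3; Theses-free, definition-free helper for the holder res-L0-w41-lead-1's line
`switching_dichotomy`, registered residual `stub_eternalCyclesSSM` (S3ᴹ) and strat-1's split
`EternalCyclesSSMFin ∧ EternalCyclesSSMInf → EternalCyclesSSM` (`L/res-L0-w41-strat-1/Sketch-census-section.lean` §D1);
replaces the role of no printed item; NOT a statement of the manuscript under review [claim: Hironaka2017, status: under-review];
AI-produced, which is weaker than expert review). Both statements are strat-1's `BoundedGapsDiverge` / `InfOfDivergentRadii`
VERBATIM with `IsExcParam` / `IsFracOf` / `GenAt` / `DistFinite` unfolded.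

* **D1♯(a) `boundedGapsDiverge`.** Rank one; members `R i ⊆ R (i+1)`; exceptional parameters `x i` whose values DIVERGE
  (`∀ c ≠ 0, ∃ m, ∏_{i<m} v (x i) < v c` — E-8 `divergent_of_core_not_isTorsorRun`, p507885, in the heart); a monotone stage map
  `Mj` with BOUNDED delays `Mj (j+1) ≤ Mj j + L`; cycle monomials `μ j`, non-units of `R (Mj (j+1))`. Then the cycle radii diverge
  too: `∀ c ≠ 0, ∃ m, ∏_{l<m} v (μ l) < v c`. Proof: `i ↦ v (x i)` is non-decreasing and `v (μ l) ≤ v (x (Mj (l+1)))` (maximality of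
  exceptional parameters), so the block `[Mj (l+1), Mj (l+2))` of at most `L` exceptional values has product `≥ v (μ l) ^ L`,
  whence `(∏_{l<m} v (μ l)) ^ L · ∏_{i<Mj 1} v (x i) ≤ ∏_{i<Mj (m+1)} v (x i) → 0`; if instead `Mj` is bounded by `N`, every
  `v (μ l) ≤ v (x N) < 1` and the archimedean property concludes.
* **D1♯(b) `infOfDivergentRadii`.** Along a cycle run `s j = μ j · (s (j+1) + c j)` (`v (c j) = 1`, `v (s j) < 1`, data in members
  `R i ⊆ O ∩ Frac A₀`) the DIGIT SUMS `G_j = Σ_{i<j} (∏_{l≤i} μ l) · c i ∈ O ∩ Frac A₀` satisfy `s 0 − G_j = (∏_{l<j} μ l) · s j`, so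
  divergent radii make `s 0` — and every element of `R (Mj 0)[s 0]`, in particular `t` (`GenAt`) — a `v`-LIMIT of elements of
  `Frac A₀`: `¬ DistFinite O A₀ t`. (The cycle twin of E-9 `run_digit_expansion`, p508727.)

Consequence recorded by strat-1: in the heart (`Σ v(𝔪_i) = ∞` by E-8) BOUNDED monomialization delays force the `Inf` half
(`t ∈` completion of `Frac A₀`); the `Fin` half `EternalCyclesSSMFin` has UNBOUNDED delays. [folklore]
-/

-- `Summit.<S>.<S>.…` duplicates the summit name by design (single-problem summit).
set_option linter.dupNamespace false

open IsLocalRing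
open Literature.AlgebraicGeometry.Resolution

namespace Summit.ResolutionOfSingularities.ResolutionOfSingularities.Theorems.SwitchingDichotomy

namespace EventualMonomial

variable {K : Type} [Field K]

/-! ## D1♯(a) · bounded delays ⇒ divergent cycle radii -/

/-- **D1♯(a) `BoundedGapsDiverge`** (res-L0-w41-strat-1, Sketch-census-section §D1♯, verbatim with `IsExcParam` unfolded).
[folklore] -/
theorem boundedGapsDiverge (O : ValuationSubring K) (hr : Nonempty O.valuation.RankOne)
    (R : ℕ → Subring K) (hmono : ∀ i, R i ≤ R (i + 1))
    (x : ℕ → K)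
    (hx : ∀ i, x i ∈ R i ∧ x i ≠ 0 ∧ O.valuation (x i) < 1 ∧
      ∀ y ∈ R i, O.valuation y < 1 → O.valuation y ≤ O.valuation (x i))
    (hdiv : ∀ c : K, c ≠ 0 → ∃ m, (∏ i ∈ Finset.range m, O.valuation (x i)) < O.valuation c)
    (Mj : ℕ → ℕ) (L : ℕ) (hMj : Monotone Mj) (hgap : ∀ j, Mj (j + 1) ≤ Mj j + L)
    (μ : ℕ → K) (hμ : ∀ j, μ j ∈ R (Mj (j + 1)) ∧ O.valuation (μ j) < 1) :
    ∀ c : K, c ≠ 0 → ∃ m, (∏ l ∈ Finset.range m, O.valuation (μ l)) < O.valuation c := by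
  classical
  intro c hc0
  -- shorthand: the exceptional values `g i := v (x i)` and their partial products `P n`
  let g : ℕ → O.ValueGroup := fun i => O.valuation (x i)
  let P : ℕ → O.ValueGroup := fun n => ∏ i ∈ Finset.range n, g i
  have hg1 : ∀ i, g i ≤ 1 := fun i => (hx i).2.2.1.le
  have hg0 : ∀ i, 0 < g i := fun i => (Valuation.pos_iff _).mpr (hx i).2.1
  -- `g` is non-decreasing: `x i ∈ R (i+1)` has value `< 1`, hence `≤ v (x (i+1))`
  have hg_succ : ∀ i, g i ≤ g (i + 1) := fun i =>
    (hx (i + 1)).2.2.2 (x i) (hmono i (hx i).1) (hx i).2.2.1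
  have hg_mono : Monotone g := monotone_nat_of_le_succ hg_succ
  -- `v (μ l) ≤ g (Mj (l+1))`
  have hμg : ∀ l, O.valuation (μ l) ≤ g (Mj (l + 1)) := fun l =>
    (hx (Mj (l + 1))).2.2.2 (μ l) (hμ l).1 (hμ l).2
  -- `P` is antitone and positive
  have hP_add : ∀ n d, P (n + d) = P n * ∏ i ∈ Finset.range d, g (n + i) := fun n d =>
    Finset.prod_range_add g n d
  have hP_anti : ∀ n d, P (n + d) ≤ P n := fun n d => by
    rw [hP_add]
    exact mul_le_of_le_one_right zero_le (Finset.prod_le_one (fun i _ => zero_le) fun i _ => hg1 _)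
  have hP_pos : ∀ n, 0 < P n := fun n => Finset.prod_pos fun i _ => hg0 i
  by_cases hbd : ∃ N, ∀ m, Mj m ≤ N
  · -- bounded stage map: every `v (μ l) ≤ g N < 1`, archimedean
    obtain ⟨N, hN⟩ := hbd
    have hle : ∀ l, O.valuation (μ l) ≤ g N := fun l => (hμg l).trans (hg_mono (hN (l + 1)))
    obtain ⟨m, hm⟩ := exists_pow_valuation_lt_of_rankOne O hr (hx N).2.2.1 hc0
    refine ⟨m, lt_of_le_of_lt ?_ hm⟩
    calc (∏ l ∈ Finset.range m, O.valuation (μ l)) ≤ ∏ _l ∈ Finset.range m, g N :=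
          Finset.prod_le_prod (fun l _ => zero_le) fun l _ => hle l
      _ = O.valuation (x N) ^ m := by rw [Finset.prod_const, Finset.card_range]
  · -- unbounded stage map: block estimate
    push Not at hbd
    -- `Q m := P (Mj (m+1)) ≥ P (Mj 1) * (∏_{l<m} v (μ l)) ^ L`
    have hblock : ∀ l, O.valuation (μ l) ^ L ≤
        ∏ i ∈ Finset.range (Mj (l + 2) - Mj (l + 1)), g (Mj (l + 1) + i) := by
      intro l
      have hgap' : Mj (l + 2) ≤ Mj (l + 1) + L := hgap (l + 1)
      have hd : Mj (l + 2) - Mj (l + 1) ≤ L := by omega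
      calc O.valuation (μ l) ^ L ≤ O.valuation (μ l) ^ (Mj (l + 2) - Mj (l + 1)) :=
            pow_le_pow_right_of_le_one' (hμ l).2.le hd
        _ = ∏ _i ∈ Finset.range (Mj (l + 2) - Mj (l + 1)), O.valuation (μ l) := by
            rw [Finset.prod_const, Finset.card_range]
        _ ≤ ∏ i ∈ Finset.range (Mj (l + 2) - Mj (l + 1)), g (Mj (l + 1) + i) :=
            Finset.prod_le_prod (fun i _ => zero_le) fun i _ =>
              (hμg l).trans (hg_mono (Nat.le_add_right _ _))
    have hQ : ∀ m, P (Mj 1) * (∏ l ∈ Finset.range m, O.valuation (μ l)) ^ L ≤ P (Mj (m + 1)) := by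
      intro m
      induction m with
      | zero => simp
      | succ m ih =>
        have hstep : P (Mj (m + 2)) = P (Mj (m + 1)) *
            ∏ i ∈ Finset.range (Mj (m + 2) - Mj (m + 1)), g (Mj (m + 1) + i) := by
          rw [← hP_add, Nat.add_sub_cancel' (hMj (Nat.le_succ (m + 1)))]
        rw [Finset.prod_range_succ, mul_pow, ← mul_assoc, hstep]
        exact mul_le_mul' ih (hblock m)
    -- divergence below the value of `(∏_{i<Mj 1} x i) * c ^ L`
    have hq0 : (∏ i ∈ Finset.range (Mj 1), x i) * c ^ L ≠ 0 :=
      mul_ne_zero (Finset.prod_ne_zero_iff.mpr fun i _ => (hx i).2.1) (pow_ne_zero L hc0)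
    obtain ⟨N, hN⟩ := hdiv _ hq0
    have hvq : O.valuation ((∏ i ∈ Finset.range (Mj 1), x i) * c ^ L) = P (Mj 1) * O.valuation c ^ L := by
      rw [map_mul, map_prod, map_pow]
    obtain ⟨m, hm⟩ := hbd N
    -- choose `m'` with `Mj (m' + 1) ≥ N`
    have hm' : N ≤ Mj (m + 1) := hm.le.trans (hMj (Nat.le_succ m))
    refine ⟨m, ?_⟩
    have h1 : P (Mj (m + 1)) ≤ P N := by
      obtain ⟨d, hd⟩ := Nat.exists_eq_add_of_le hm'
      rw [hd]
      exact hP_anti N d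
    have h2 : P (Mj 1) * (∏ l ∈ Finset.range m, O.valuation (μ l)) ^ L < P (Mj 1) * O.valuation c ^ L := by
      rw [← hvq]
      exact ((hQ m).trans h1).trans_lt hN
    have h3 : (∏ l ∈ Finset.range m, O.valuation (μ l)) ^ L < O.valuation c ^ L :=
      lt_of_mul_lt_mul_left' h2
    exact lt_of_pow_lt_pow_left₀ L zero_le h3

/-! ## D1♯(b) · divergent cycle radii ⇒ `t` is a limit of `Frac A₀` -/

/-- Fractions of elements of `A₀` (the skeleton's `IsFracOf`, unfolded) are closed under the ring operations.
[folklore] -/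
theorem isFracOf_closure {k : Type} [Field k] [Algebra k K] (A₀ : Subalgebra k K) {a b : K}
    (ha : ∃ y ∈ A₀, ∃ z ∈ A₀, z ≠ 0 ∧ a = y / z) (hb : ∃ y ∈ A₀, ∃ z ∈ A₀, z ≠ 0 ∧ b = y / z) :
    (∃ y ∈ A₀, ∃ z ∈ A₀, z ≠ 0 ∧ a + b = y / z) ∧ (∃ y ∈ A₀, ∃ z ∈ A₀, z ≠ 0 ∧ a * b = y / z) ∧
      (∃ y ∈ A₀, ∃ z ∈ A₀, z ≠ 0 ∧ -a = y / z) := by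
  have ha' := (exists_div_iff_mem_closure A₀ a).mp ha
  have hb' := (exists_div_iff_mem_closure A₀ b).mp hb
  exact ⟨(exists_div_iff_mem_closure A₀ _).mpr (add_mem ha' hb'),
    (exists_div_iff_mem_closure A₀ _).mpr (mul_mem ha' hb'),
    (exists_div_iff_mem_closure A₀ _).mpr (neg_mem ha')⟩

/-- **Cycle digit expansion.** Along `s j = μ j * (s (j + 1) + c j)` with data in members `R i ⊆ O` consisting of fractions of
`A₀`: for every `j` a digit sum `G ∈ O`, a fraction of `A₀`, with `s 0 - G = (∏_{l<j} μ l) * s j`. [folklore] -/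
theorem cycle_digit_expansion {k : Type} [Field k] [Algebra k K] (O : ValuationSubring K) (A₀ : Subalgebra k K)
    (R : ℕ → Subring K) (hRO : ∀ i, R i ≤ O.toSubring)
    (hRfrac : ∀ i, ∀ y ∈ R i, ∃ a ∈ A₀, ∃ b ∈ A₀, b ≠ 0 ∧ y = a / b)
    (Mj : ℕ → ℕ) (s μ c : ℕ → K)
    (hcyc : ∀ j, μ j ∈ R (Mj (j + 1)) ∧ c j ∈ R (Mj (j + 1)) ∧ O.valuation (c j) = 1 ∧
      s j = μ j * (s (j + 1) + c j)) (j : ℕ) :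
    ∃ G : K, G ∈ O ∧ (∃ a ∈ A₀, ∃ b ∈ A₀, b ≠ 0 ∧ G = a / b) ∧
      s 0 - G = (∏ l ∈ Finset.range j, μ l) * s j := by
  classical
  induction j with
  | zero => exact ⟨0, O.zero_mem, ⟨0, A₀.zero_mem, 1, A₀.one_mem, one_ne_zero, by simp⟩, by simp⟩
  | succ j ih =>
    obtain ⟨G, hGO, hGf, hG⟩ := ih
    obtain ⟨hμR, hcR, -, hsj⟩ := hcyc j
    have hπO : (∏ l ∈ Finset.range j, μ l) ∈ O :=
      prod_mem fun l _ => hRO _ (hcyc l).1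
    have hπf : ∃ a ∈ A₀, ∃ b ∈ A₀, b ≠ 0 ∧ (∏ l ∈ Finset.range j, μ l) = a / b := by
      refine (exists_div_iff_mem_closure A₀ _).mpr (prod_mem fun l _ => ?_)
      exact (exists_div_iff_mem_closure A₀ _).mp (hRfrac _ _ (hcyc l).1)
    refine ⟨G + (∏ l ∈ Finset.range j, μ l) * μ j * c j,
      add_mem hGO (mul_mem (mul_mem hπO (hRO _ hμR)) (hRO _ hcR)), ?_, ?_⟩
    · have h1 := (isFracOf_closure A₀ hπf (hRfrac _ _ hμR)).2.1
      have h2 := (isFracOf_closure A₀ h1 (hRfrac _ _ hcR)).2.1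
      exact (isFracOf_closure A₀ hGf h2).1
    · rw [Finset.prod_range_succ]
      linear_combination hG + (∏ l ∈ Finset.range j, μ l) * hsj

/-- **D1♯(b) `InfOfDivergentRadii`** (res-L0-w41-strat-1, Sketch-census-section §D1♯, verbatim with `GenAt` / `IsFracOf` /
`DistFinite` unfolded): divergent cycle radii make `t` a `v`-limit of `Frac A₀`. [folklore] -/
theorem infOfDivergentRadii (p : ℕ) (k : Type) [Field k] [Algebra k K] (O : ValuationSubring K)
    (A₀ : Subalgebra k K) (t : K) (_hr : Nonempty O.valuation.RankOne) (_h₀ : A₀.toSubring ≤ O.toSubring)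
    (R : ℕ → Subring K) (hRO : ∀ i, R i ≤ O.toSubring)
    (hRfrac : ∀ i, ∀ y ∈ R i, ∃ a ∈ A₀, ∃ b ∈ A₀, b ≠ 0 ∧ y = a / b)
    (Mj : ℕ → ℕ) (s μ c : ℕ → K)
    (hgen : s 0 ^ p ∈ R (Mj 0) ∧ t ∈ Subring.closure (insert (s 0) (R (Mj 0) : Set K)))
    (hs : ∀ j, O.valuation (s j) < 1)
    (hcyc : ∀ j, μ j ∈ R (Mj (j + 1)) ∧ c j ∈ R (Mj (j + 1)) ∧ O.valuation (c j) = 1 ∧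
      s j = μ j * (s (j + 1) + c j))
    (hdiv : ∀ w : K, w ≠ 0 → ∃ m, (∏ l ∈ Finset.range m, O.valuation (μ l)) < O.valuation w) :
    ¬ ∃ w : K, (∃ y ∈ A₀, ∃ z ∈ A₀, z ≠ 0 ∧ w = y / z) ∧ w ≠ 0 ∧
      ∀ g : K, (∃ y ∈ A₀, ∃ z ∈ A₀, z ≠ 0 ∧ g = y / z) → O.valuation w ≤ O.valuation (t - g) := by
  classical
  -- «`y ∈ O` is a `v`-limit of fractions of `A₀` inside `O`»
  let Lim : K → Prop := fun y => y ∈ O ∧ ∀ w : K, w ≠ 0 →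
    ∃ g : K, (∃ a ∈ A₀, ∃ b ∈ A₀, b ≠ 0 ∧ g = a / b) ∧ g ∈ O ∧ O.valuation (y - g) < O.valuation w
  -- elements of the member, and `s 0`, are limits
  have hmem : ∀ y ∈ R (Mj 0), Lim y := fun y hy =>
    ⟨hRO _ hy, fun w hw => ⟨y, hRfrac _ y hy, hRO _ hy, by
      rw [sub_self, map_zero]; exact (Valuation.pos_iff _).mpr hw⟩⟩
  have hs0 : Lim (s 0) := by
    refine ⟨(O.valuation_le_one_iff _).mp (hs 0).le, fun w hw => ?_⟩
    obtain ⟨m, hm⟩ := hdiv w hw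
    obtain ⟨G, hGO, hGf, hG⟩ := cycle_digit_expansion O A₀ R hRO hRfrac Mj s μ c hcyc m
    refine ⟨G, hGf, hGO, ?_⟩
    rw [hG, map_mul, map_prod]
    exact (mul_le_of_le_one_right zero_le (hs m).le).trans_lt hm
  -- limits form a subring
  have hadd : ∀ a b, Lim a → Lim b → Lim (a + b) := by
    rintro a b ⟨haO, ha⟩ ⟨hbO, hb⟩
    refine ⟨add_mem haO hbO, fun w hw => ?_⟩
    obtain ⟨g₁, hg₁f, hg₁O, h₁⟩ := ha w hw
    obtain ⟨g₂, hg₂f, hg₂O, h₂⟩ := hb w hw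
    refine ⟨g₁ + g₂, (isFracOf_closure A₀ hg₁f hg₂f).1, add_mem hg₁O hg₂O, ?_⟩
    have : a + b - (g₁ + g₂) = (a - g₁) + (b - g₂) := by ring
    rw [this]
    exact Valuation.map_add_lt _ h₁ h₂
  have hneg : ∀ a, Lim a → Lim (-a) := by
    rintro a ⟨haO, ha⟩
    refine ⟨neg_mem haO, fun w hw => ?_⟩
    obtain ⟨g, hgf, hgO, h⟩ := ha w hw
    refine ⟨-g, (isFracOf_closure A₀ hgf hgf).2.2, neg_mem hgO, ?_⟩
    have : -a - -g = -(a - g) := by ring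
    rwa [this, Valuation.map_neg]
  have hmul : ∀ a b, Lim a → Lim b → Lim (a * b) := by
    rintro a b ⟨haO, ha⟩ ⟨hbO, hb⟩
    refine ⟨mul_mem haO hbO, fun w hw => ?_⟩
    obtain ⟨g₁, hg₁f, hg₁O, h₁⟩ := ha w hw
    obtain ⟨g₂, hg₂f, hg₂O, h₂⟩ := hb w hw
    refine ⟨g₁ * g₂, (isFracOf_closure A₀ hg₁f hg₂f).2.1, mul_mem hg₁O hg₂O, ?_⟩
    have : a * b - g₁ * g₂ = a * (b - g₂) + g₂ * (a - g₁) := by ring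
    rw [this]
    refine Valuation.map_add_lt _ ?_ ?_
    · rw [map_mul]
      exact (mul_le_of_le_one_left zero_le ((O.valuation_le_one_iff _).mpr haO)).trans_lt h₂
    · rw [map_mul]
      exact (mul_le_of_le_one_left zero_le ((O.valuation_le_one_iff _).mpr hg₂O)).trans_lt h₁
  -- hence `t ∈ R (Mj 0)[s 0]` is a limit
  have ht : Lim t := by
    refine Subring.closure_induction (p := fun y _ => Lim y) ?_ ?_ ?_ (fun a b _ _ => hadd a b)
      (fun a _ => hneg a) (fun a b _ _ => hmul a b) hgen.2
    · rintro y (rfl | hy)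
      · exact hs0
      · exact hmem y hy
    · exact hmem 0 (Subring.zero_mem _)
    · exact hmem 1 (Subring.one_mem _)
  -- no positive lower bound on the approximation errors
  rintro ⟨w, -, hw0, hbound⟩
  obtain ⟨g, hgf, -, hlt⟩ := ht.2 w hw0
  exact not_lt.mpr (hbound g hgf) hlt

end EventualMonomial

end Summit.ResolutionOfSingularities.ResolutionOfSingularities.Theorems.SwitchingDichotomy
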